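import Mathlib
import HarnessLib
import Summits.HubbardSuperconductivity.HubbardSuperconductivity.Theorems.KLProgrammeKLRegimeEnginePairTransferKernelOfConserving

/-!
# Route `KLProgramme` — engine support (row (X).1 / #14 «S3 IN U-CURRENCY», NORM side, brick (T7)): the PLAIN FOUR-LEG LINE FROM A MOMENTUM-SPACE
# REPRESENTATION — one call composing the dictionary (T5b), the bump bound (T1) and the superposition bound (T2)

Cell gate-hubbard-kl, seat hubbard-kl-k3c2-p3 (g16).  The E1-facing form of the (X).1 norm-side chain (pen (R390)/(R394)(F) item (5′)): a producer who shows that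
the degree-4 MOMENTUM kernel of a Grassmann element `𝒱` on the charge string `(+,+,−,−)` (spins `σ`) is a finite superposition of CONSERVING TRANSFER BUMPS plus a
remainder,
  `kernel ℂ 𝒱 4 ((k_i,σ_i),c_i) = Σ_{i∈S} a_i · κ·[k̄₀+k̄₁ = k̄₂+k̄₃]·G_i(−(k̄₀+k̄₁)) + ρ(k)`
(`k̄` the torus image, `G_i` symbols on `(ℤ/2M)¹×(ℤ/L)²` with (T1)-bump data — e.g. the canonical product bumps of (T4) — and `κ` the normalisation), obtains the
plain four-leg pinned line of `𝒱` at that label string: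
  `fixedTupleL1 L M β 3 (sectorisedKernel … trivialMultiplier 𝒱 4) Ω y ≤ ε_x³·‖κ‖(2M·L²)²·√(10485760·n₀)·(2M·L²)·Σ_i ‖a_i‖·A_i + r`,
`r` the plain line of the remainder's plane-wave transform.  With `A_i = 1`, `Σ_i‖a_i‖ ≤ V` (child 1's row 7 under (s2)) this is `U`-currency.

* §1 **`planeWaveSum_eq_pairTransfer_of_conserving`**, `norm_planeWaveSum_le_pairTransfer_of_conserving` — the kernel-FUNCTION form of (T5b): for any
  `K : (Fin 4 → FreqMomentum) → ℂ` with `K k = κ·[k̄₀+k̄₁ = k̄₂+k̄₃]·f(k̄₀+k̄₁)`, `Σ_k (∏_i e^{∓ik_i·x_i})·K(k)` is the pair-transfer form (symbol `Q ↦ f(−Q)`);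
* §2 **`plainFourLegLine_of_momentumRepresentation`** — the one-call bound above (hypotheses: the representation `hker`, (T1)-bump data of the `G_i`, the
  remainder's plain line `hr`).

Everything is proved; no definitions, no named facts; `hker` is asserted for no engine object; nothing here asserts (X).1, (b), any stub, K3 or superconductivity.
[folklore]  References: BGM 2006 §2.3 (2.17), §3 (3.65) [cite: BenfattoGiulianiMastropietro2006]; Katznelson Ch. I §6.3.
-/

noncomputable section

namespace Summit.HubbardSuperconductivity.HubbardSuperconductivity.Theorems.TorusFourierL2

set_option linter.dupNamespace false -- summit = problem name (single-conjunct summit), D-0017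

open Finset Complex Literature.Probability.LatticeModels Literature.MathematicalPhysics.QuantumLattice
open Literature.MathematicalPhysics.QuantumLattice.GrassmannAlgebra
open Summit.HubbardSuperconductivity.HubbardSuperconductivity.Theorems.KLRegimeSplit
open scoped Real ComplexConjugate

variable {L M : ℕ} [NeZero L] [NeZero M]

/-! ### §1 The kernel-function form of the dictionary -/

/-- **Plane-wave sums of a conserving transfer-only four-momentum function are pair-transfer forms** (charges `(+,+,−,−)`).
[cite: BenfattoGiulianiMastropietro2006, §2.3 (2.17)] -/
theorem planeWaveSum_eq_pairTransfer_of_conserving {β : ℝ} (hβ : β ≠ 0) (σ : Fin 4 → Fin 2) (K : (Fin 4 → FreqMomentum L M) → ℂ)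
    (κ : ℂ) (f : TorusSite 1 (2 * M) × TorusSite 2 L → ℂ)
    (hker : ∀ k : Fin 4 → FreqMomentum L M, K k = κ * (if ((fun _ : Fin 1 => ((((k 0).1 : ℕ) : ZMod (2 * M)))), (k 0).2) + ((fun _ : Fin 1 => ((((k 1).1 : ℕ) : ZMod (2 * M)))), (k 1).2) = (((fun _ : Fin 1 => ((((k 2).1 : ℕ) : ZMod (2 * M)))), (k 2).2) : TorusSite 1 (2 * M) × TorusSite 2 L) + ((fun _ : Fin 1 => ((((k 3).1 : ℕ) : ZMod (2 * M)))), (k 3).2) then f (((fun _ : Fin 1 => ((((k 0).1 : ℕ) : ZMod (2 * M)))), (k 0).2) + ((fun _ : Fin 1 => ((((k 1).1 : ℕ) : ZMod (2 * M)))), (k 1).2)) else 0))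
    (x : Fin 4 → SpaceTimeIdx L M) :
    ∑ k : Fin 4 → FreqMomentum L M, (∏ i, trivialMultiplier L M ((fun i : Fin 4 => ((((0 : Fin 1), σ i) : Fin 1 × Fin 2), (![0, 0, 1, 1] : Fin 4 → Fin 2) i)) i).1.1 (k i) * hubbardPlaneWave L M β ((fun i : Fin 4 => ((((0 : Fin 1), σ i) : Fin 1 × Fin 2), (![0, 0, 1, 1] : Fin 4 → Fin 2) i)) i).2 (k i) (x i)) * K k =
      (conj (Complex.exp (((π * (1 - 2 * M) * (((x 0).1 : ℕ) : ℝ) / (2 * M) : ℝ) : ℂ) * I)) * conj (Complex.exp (((π * (1 - 2 * M) * (((x 1).1 : ℕ) : ℝ) / (2 * M) : ℝ) : ℂ) * I)) * Complex.exp (((π * (1 - 2 * M) * (((x 2).1 : ℕ) : ℝ) / (2 * M) : ℝ) : ℂ) * I) * Complex.exp (((π * (1 - 2 * M) * (((x 3).1 : ℕ) : ℝ) / (2 * M) : ℝ) : ℂ) * I) * κ) *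
        (if x 1 = x 0 ∧ x 3 = x 2 then ((((2 * M : ℕ) : ℂ) * (L : ℂ) ^ 2) ^ 2) *
          ∑ Q : TorusSite 1 (2 * M) × TorusSite 2 L, (torusChar (Q).1 ((((fun _ : Fin 1 => ((((x 0).1 : ℕ) : ZMod (2 * M)))), (x 0).2) : TorusSite 1 (2 * M) × TorusSite 2 L) - (((fun _ : Fin 1 => ((((x 2).1 : ℕ) : ZMod (2 * M)))), (x 2).2) : TorusSite 1 (2 * M) × TorusSite 2 L)).1 * torusChar (Q).2 ((((fun _ : Fin 1 => ((((x 0).1 : ℕ) : ZMod (2 * M)))), (x 0).2) : TorusSite 1 (2 * M) × TorusSite 2 L) - (((fun _ : Fin 1 => ((((x 2).1 : ℕ) : ZMod (2 * M)))), (x 2).2) : TorusSite 1 (2 * M) × TorusSite 2 L)).2) * f (-Q) else 0) := by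
  classical
  have ht : ∀ (ω : Fin 1) (q : FreqMomentum L M), trivialMultiplier L M ω q = 1 := fun _ _ => rfl
  have hterm : ∀ k : Fin 4 → FreqMomentum L M, (∏ i, trivialMultiplier L M ((fun i : Fin 4 => ((((0 : Fin 1), σ i) : Fin 1 × Fin 2), (![0, 0, 1, 1] : Fin 4 → Fin 2) i)) i).1.1 (k i) * hubbardPlaneWave L M β ((fun i : Fin 4 => ((((0 : Fin 1), σ i) : Fin 1 × Fin 2), (![0, 0, 1, 1] : Fin 4 → Fin 2) i)) i).2 (k i) (x i)) * K k = (conj (Complex.exp (((π * (1 - 2 * M) * (((x 0).1 : ℕ) : ℝ) / (2 * M) : ℝ) : ℂ) * I)) * conj (Complex.exp (((π * (1 - 2 * M) * (((x 1).1 : ℕ) : ℝ) / (2 * M) : ℝ) : ℂ) * I)) * Complex.exp (((π * (1 - 2 * M) * (((x 2).1 : ℕ) : ℝ) / (2 * M) : ℝ) : ℂ) * I) * Complex.exp (((π * (1 - 2 * M) * (((x 3).1 : ℕ) : ℝ) / (2 * M) : ℝ) : ℂ) * I) * κ) * ((torusChar (((fun _ : Fin 1 => ((((k 0).1 : ℕ)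 : ZMod (2 * M)))), (k 0).2)).1 (-(((fun _ : Fin 1 => ((((x 0).1 : ℕ) : ZMod (2 * M)))), (x 0).2) : TorusSite 1 (2 * M) × TorusSite 2 L)).1 * torusChar (((fun _ : Fin 1 => ((((k 0).1 : ℕ) : ZMod (2 * M)))), (k 0).2)).2 (-(((fun _ : Fin 1 => ((((x 0).1 : ℕ) : ZMod (2 * M)))), (x 0).2) : TorusSite 1 (2 * M) × TorusSite 2 L)).2) * (torusChar (((fun _ : Fin 1 => ((((k 1).1 : ℕ) : ZMod (2 * M)))), (k 1).2)).1 (-(((fun _ : Fin 1 => ((((x 1).1 : ℕ) : ZMod (2 * M)))), (x 1).2) : TorusSite 1 (2 * M) × TorusSite 2 L)).1 * torusChar (((fun _ : Fin 1 => ((((k 1).1 : ℕ) : ZMod (2 * M)))), (k 1).2)).2 (-(((fun _ : Fin 1 => ((((x 1).1 : ℕ) : ZMod (2 * M)))), (x 1).2) : TorusSite 1 (2 * M) × TorusSite 2 L)).2) * (torusChar (((fun _ : Fin 1 => ((((k 2).1 : ℕ) : ZMod (2 * M)))), (k 2).2)).1 ((((fun _ : Fin 1 => ((((x 2).1 : ℕ)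 : ZMod (2 * M)))), (x 2).2) : TorusSite 1 (2 * M) × TorusSite 2 L)).1 * torusChar (((fun _ : Fin 1 => ((((k 2).1 : ℕ) : ZMod (2 * M)))), (k 2).2)).2 ((((fun _ : Fin 1 => ((((x 2).1 : ℕ) : ZMod (2 * M)))), (x 2).2) : TorusSite 1 (2 * M) × TorusSite 2 L)).2) * (torusChar (((fun _ : Fin 1 => ((((k 3).1 : ℕ) : ZMod (2 * M)))), (k 3).2)).1 ((((fun _ : Fin 1 => ((((x 3).1 : ℕ) : ZMod (2 * M)))), (x 3).2) : TorusSite 1 (2 * M) × TorusSite 2 L)).1 * torusChar (((fun _ : Fin 1 => ((((k 3).1 : ℕ) : ZMod (2 * M)))), (k 3).2)).2 ((((fun _ : Fin 1 => ((((x 3).1 : ℕ) : ZMod (2 * M)))), (x 3).2) : TorusSite 1 (2 * M) × TorusSite 2 L)).2) * (if ((fun _ : Fin 1 => ((((k 0).1 : ℕ) : ZMod (2 * M)))), (k 0).2) + ((fun _ : Fin 1 => ((((k 1).1 : ℕ) : ZMod (2 * M)))), (k 1).2) = (((fun _ : Fin 1 => ((((k 2).1 : ℕ) : ZMod (2 *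 M)))), (k 2).2) : TorusSite 1 (2 * M) × TorusSite 2 L) + ((fun _ : Fin 1 => ((((k 3).1 : ℕ) : ZMod (2 * M)))), (k 3).2) then f (((fun _ : Fin 1 => ((((k 0).1 : ℕ) : ZMod (2 * M)))), (k 0).2) + ((fun _ : Fin 1 => ((((k 1).1 : ℕ) : ZMod (2 * M)))), (k 1).2)) else 0)) := by
    intro k
    rw [hker k, Fin.prod_univ_four]
    simp only [ht, one_mul]
    show hubbardPlaneWave L M β 0 (k 0) (x 0) * hubbardPlaneWave L M β 0 (k 1) (x 1) * hubbardPlaneWave L M β 1 (k 2) (x 2) *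
        hubbardPlaneWave L M β 1 (k 3) (x 3) * (κ * (if ((fun _ : Fin 1 => ((((k 0).1 : ℕ) : ZMod (2 * M)))), (k 0).2) + ((fun _ : Fin 1 => ((((k 1).1 : ℕ) : ZMod (2 * M)))), (k 1).2) = (((fun _ : Fin 1 => ((((k 2).1 : ℕ) : ZMod (2 * M)))), (k 2).2) : TorusSite 1 (2 * M) × TorusSite 2 L) + ((fun _ : Fin 1 => ((((k 3).1 : ℕ) : ZMod (2 * M)))), (k 3).2) then f (((fun _ : Fin 1 => ((((k 0).1 : ℕ) : ZMod (2 * M)))), (k 0).2) + ((fun _ : Fin 1 => ((((k 1).1 : ℕ) : ZMod (2 * M)))), (k 1).2)) else 0)) = _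
    rw [hubbardPlaneWave_zero_eq_phase_mul_pchar hβ, hubbardPlaneWave_zero_eq_phase_mul_pchar hβ,
      hubbardPlaneWave_one_eq_phase_mul_pchar hβ, hubbardPlaneWave_one_eq_phase_mul_pchar hβ]
    simp only [Prod.fst_neg, Prod.snd_neg]
    ring
  simp_rw [hterm]
  rw [← mul_sum]
  have hsum4 : ∑ k : Fin 4 → FreqMomentum L M, (torusChar (((fun _ : Fin 1 => ((((k 0).1 : ℕ) : ZMod (2 * M)))), (k 0).2)).1 (-(((fun _ : Fin 1 => ((((x 0).1 : ℕ) : ZMod (2 * M)))), (x 0).2) : TorusSite 1 (2 * M) × TorusSite 2 L)).1 * torusChar (((fun _ : Fin 1 => ((((k 0).1 : ℕ) : ZMod (2 * M)))), (k 0).2)).2 (-(((fun _ : Fin 1 => ((((x 0).1 : ℕ) : ZMod (2 * M)))), (x 0).2) : TorusSite 1 (2 * M) × TorusSite 2 L)).2) * (torusChar (((fun _ : Fin 1 => ((((k 1).1 : ℕ) : ZMod (2 * M)))), (k 1).2)).1 (-(((fun _ : Fin 1 => ((((x 1).1 : ℕ) : ZMod (2 * M)))), (x 1).2) : TorusSite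 1 (2 * M) × TorusSite 2 L)).1 * torusChar (((fun _ : Fin 1 => ((((k 1).1 : ℕ) : ZMod (2 * M)))), (k 1).2)).2 (-(((fun _ : Fin 1 => ((((x 1).1 : ℕ) : ZMod (2 * M)))), (x 1).2) : TorusSite 1 (2 * M) × TorusSite 2 L)).2) * (torusChar (((fun _ : Fin 1 => ((((k 2).1 : ℕ) : ZMod (2 * M)))), (k 2).2)).1 ((((fun _ : Fin 1 => ((((x 2).1 : ℕ) : ZMod (2 * M)))), (x 2).2) : TorusSite 1 (2 * M) × TorusSite 2 L)).1 * torusChar (((fun _ : Fin 1 => ((((k 2).1 : ℕ) : ZMod (2 * M)))), (k 2).2)).2 ((((fun _ : Fin 1 => ((((x 2).1 : ℕ) : ZMod (2 * M)))), (x 2).2) : TorusSite 1 (2 * M) × TorusSite 2 L)).2) * (torusChar (((fun _ : Fin 1 => ((((k 3).1 : ℕ) : ZMod (2 * M)))), (k 3).2)).1 ((((fun _ : Fin 1 => ((((x 3).1 : ℕ) : ZMod (2 * M)))), (x 3).2) : TorusSite 1 (2 * M) × TorusSite 2 L)).1 * torusChar (((fun _ : Fin 1 => ((((k 3).1 : ℕ)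 : ZMod (2 * M)))), (k 3).2)).2 ((((fun _ : Fin 1 => ((((x 3).1 : ℕ) : ZMod (2 * M)))), (x 3).2) : TorusSite 1 (2 * M) × TorusSite 2 L)).2) * (if ((fun _ : Fin 1 => ((((k 0).1 : ℕ) : ZMod (2 * M)))), (k 0).2) + ((fun _ : Fin 1 => ((((k 1).1 : ℕ) : ZMod (2 * M)))), (k 1).2) = (((fun _ : Fin 1 => ((((k 2).1 : ℕ) : ZMod (2 * M)))), (k 2).2) : TorusSite 1 (2 * M) × TorusSite 2 L) + ((fun _ : Fin 1 => ((((k 3).1 : ℕ) : ZMod (2 * M)))), (k 3).2) then f (((fun _ : Fin 1 => ((((k 0).1 : ℕ) : ZMod (2 * M)))), (k 0).2) + ((fun _ : Fin 1 => ((((k 1).1 : ℕ) : ZMod (2 * M)))), (k 1).2)) else 0) =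
      ∑ p₀ : TorusSite 1 (2 * M) × TorusSite 2 L, ∑ p₁ : TorusSite 1 (2 * M) × TorusSite 2 L, ∑ p₂ : TorusSite 1 (2 * M) × TorusSite 2 L, ∑ p₃ : TorusSite 1 (2 * M) × TorusSite 2 L, (torusChar (p₀).1 (-(((fun _ : Fin 1 => ((((x 0).1 : ℕ) : ZMod (2 * M)))), (x 0).2) : TorusSite 1 (2 * M) × TorusSite 2 L)).1 * torusChar (p₀).2 (-(((fun _ : Fin 1 => ((((x 0).1 : ℕ) : ZMod (2 * M)))), (x 0).2) : TorusSite 1 (2 * M) × TorusSite 2 L)).2) * (torusChar (p₁).1 (-(((fun _ : Fin 1 => ((((x 1).1 : ℕ) : ZMod (2 * M)))), (x 1).2) : TorusSite 1 (2 * M) × TorusSite 2 L)).1 * torusChar (p₁).2 (-(((fun _ : Fin 1 => ((((x 1).1 : ℕ) : ZMod (2 * M)))), (x 1).2) : TorusSite 1 (2 * M) × TorusSite 2 L)).2) * (torusChar (p₂).1 ((((fun _ : Fin 1 => ((((x 2).1 : ℕ) : ZMod (2 * M)))), (x 2).2) : TorusSite 1 (2 * M) × TorusSite 2 L)).1 *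 torusChar (p₂).2 ((((fun _ : Fin 1 => ((((x 2).1 : ℕ) : ZMod (2 * M)))), (x 2).2) : TorusSite 1 (2 * M) × TorusSite 2 L)).2) * (torusChar (p₃).1 ((((fun _ : Fin 1 => ((((x 3).1 : ℕ) : ZMod (2 * M)))), (x 3).2) : TorusSite 1 (2 * M) × TorusSite 2 L)).1 * torusChar (p₃).2 ((((fun _ : Fin 1 => ((((x 3).1 : ℕ) : ZMod (2 * M)))), (x 3).2) : TorusSite 1 (2 * M) × TorusSite 2 L)).2) * (if p₀ + p₁ = p₂ + p₃ then f (p₀ + p₁) else 0) :=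
    sum_tuple4_freqMomentum_eq (fun p₀ p₁ p₂ p₃ => (torusChar (p₀).1 (-(((fun _ : Fin 1 => ((((x 0).1 : ℕ) : ZMod (2 * M)))), (x 0).2) : TorusSite 1 (2 * M) × TorusSite 2 L)).1 * torusChar (p₀).2 (-(((fun _ : Fin 1 => ((((x 0).1 : ℕ) : ZMod (2 * M)))), (x 0).2) : TorusSite 1 (2 * M) × TorusSite 2 L)).2) * (torusChar (p₁).1 (-(((fun _ : Fin 1 => ((((x 1).1 : ℕ) : ZMod (2 * M)))), (x 1).2) : TorusSite 1 (2 * M) × TorusSite 2 L)).1 * torusChar (p₁).2 (-(((fun _ : Fin 1 => ((((x 1).1 : ℕ) : ZMod (2 * M)))), (x 1).2) : TorusSite 1 (2 * M) × TorusSite 2 L)).2) * (torusChar (p₂).1 ((((fun _ : Fin 1 => ((((x 2).1 : ℕ) : ZMod (2 * M)))), (x 2).2) : TorusSite 1 (2 * M) × TorusSite 2 L)).1 * torusChar (p₂).2 ((((fun _ : Fin 1 => ((((x 2).1 : ℕ) : ZMod (2 * M)))), (x 2).2) : TorusSite 1 (2 * M) × TorusSite 2 L)).2) * (torusChar (p₃).1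 ((((fun _ : Fin 1 => ((((x 3).1 : ℕ) : ZMod (2 * M)))), (x 3).2) : TorusSite 1 (2 * M) × TorusSite 2 L)).1 * torusChar (p₃).2 ((((fun _ : Fin 1 => ((((x 3).1 : ℕ) : ZMod (2 * M)))), (x 3).2) : TorusSite 1 (2 * M) × TorusSite 2 L)).2) * (if p₀ + p₁ = p₂ + p₃ then f (p₀ + p₁) else 0))
  rw [hsum4, fourLeg_transfer_charSum_eq f (((fun _ : Fin 1 => ((((x 0).1 : ℕ) : ZMod (2 * M)))), (x 0).2) : TorusSite 1 (2 * M) × TorusSite 2 L) (((fun _ : Fin 1 => ((((x 1).1 : ℕ) : ZMod (2 * M)))), (x 1).2) : TorusSite 1 (2 * M) × TorusSite 2 L) (((fun _ : Fin 1 => ((((x 2).1 : ℕ) : ZMod (2 * M)))), (x 2).2) : TorusSite 1 (2 * M) × TorusSite 2 L) (((fun _ : Fin 1 => ((((x 3).1 : ℕ) : ZMod (2 * M)))), (x 3).2) : TorusSite 1 (2 * M) × TorusSite 2 L)]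
  congr 1
  refine if_congr ⟨fun h => ⟨xbar_injective h.1, xbar_injective h.2⟩, fun h => ?_⟩ rfl rfl
  rw [h.1, h.2]; exact ⟨rfl, rfl⟩

/-- Norm form: the hypothesis `hB` of (T2) for the plane-wave sum of a conserving transfer-only function (pairing `{0,1}{2,3}`,
`c := ‖κ‖·(2M·L²)²`, symbol `Q ↦ f(−Q)`). [cite: BenfattoGiulianiMastropietro2006, §2.3 (2.17)] -/
theorem norm_planeWaveSum_le_pairTransfer_of_conserving {β : ℝ} (hβ : β ≠ 0) (σ : Fin 4 → Fin 2) (K : (Fin 4 → FreqMomentum L M) → ℂ)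
    (κ : ℂ) (f : TorusSite 1 (2 * M) × TorusSite 2 L → ℂ)
    (hker : ∀ k : Fin 4 → FreqMomentum L M, K k = κ * (if ((fun _ : Fin 1 => ((((k 0).1 : ℕ) : ZMod (2 * M)))), (k 0).2) + ((fun _ : Fin 1 => ((((k 1).1 : ℕ) : ZMod (2 * M)))), (k 1).2) = (((fun _ : Fin 1 => ((((k 2).1 : ℕ) : ZMod (2 * M)))), (k 2).2) : TorusSite 1 (2 * M) × TorusSite 2 L) + ((fun _ : Fin 1 => ((((k 3).1 : ℕ) : ZMod (2 * M)))), (k 3).2) then f (((fun _ : Fin 1 => ((((k 0).1 : ℕ) : ZMod (2 * M)))), (k 0).2) + ((fun _ : Fin 1 => ((((k 1).1 : ℕ) : ZMod (2 * M)))), (k 1).2)) else 0))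
    (x : Fin 4 → SpaceTimeIdx L M) :
    ‖∑ k : Fin 4 → FreqMomentum L M, (∏ i, trivialMultiplier L M ((fun i : Fin 4 => ((((0 : Fin 1), σ i) : Fin 1 × Fin 2), (![0, 0, 1, 1] : Fin 4 → Fin 2) i)) i).1.1 (k i) * hubbardPlaneWave L M β ((fun i : Fin 4 => ((((0 : Fin 1), σ i) : Fin 1 × Fin 2), (![0, 0, 1, 1] : Fin 4 → Fin 2) i)) i).2 (k i) (x i)) * K k‖ ≤
      if x 1 = x 0 ∧ x 3 = x 2 then (‖κ‖ * ((((2 * M : ℕ) : ℝ) * (L : ℝ) ^ 2) ^ 2)) * ‖∑ Q : TorusSite 1 (2 * M) × TorusSite 2 L,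
        (torusChar Q.1 (fun _ : Fin 1 => (((x 0).1 : ℕ) : ZMod (2 * M)) - (((x 2).1 : ℕ) : ZMod (2 * M))) *
          torusChar Q.2 ((x 0).2 - (x 2).2)) • (fun Q => f (-Q)) Q‖ else 0 := by
  rw [planeWaveSum_eq_pairTransfer_of_conserving hβ σ K κ f hker x]
  have hu : ∀ i : Fin 4, ‖Complex.exp (((π * (1 - 2 * M) * (((x i).1 : ℕ) : ℝ) / (2 * M) : ℝ) : ℂ) * I)‖ = 1 := fun i => Complex.norm_exp_ofReal_mul_I _
  by_cases hx : x 1 = x 0 ∧ x 3 = x 2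
  · rw [if_pos hx, if_pos hx, norm_mul, norm_mul, norm_mul, norm_mul, norm_mul, norm_mul, Complex.norm_conj, Complex.norm_conj, hu 0, hu 1, hu 2, hu 3,
      norm_pow, norm_mul, Complex.norm_natCast, norm_pow, Complex.norm_natCast]
    refine le_of_eq ?_
    have hsub : ((((fun _ : Fin 1 => ((((x 0).1 : ℕ) : ZMod (2 * M)))), (x 0).2) : TorusSite 1 (2 * M) × TorusSite 2 L) - (((fun _ : Fin 1 => ((((x 2).1 : ℕ) : ZMod (2 * M)))), (x 2).2) : TorusSite 1 (2 * M) × TorusSite 2 L) : TorusSite 1 (2 * M) × TorusSite 2 L) = ((fun _ : Fin 1 => (((x 0).1 : ℕ) : ZMod (2 * M)) - (((x 2).1 : ℕ) : ZMod (2 * M))), (x 0).2 - (x 2).2) := rfl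
    rw [hsub]
    simp only [smul_eq_mul]
    ring
  · rw [if_neg hx, if_neg hx, mul_zero, norm_zero]

/-! ### §2 The one-call bound: the plain four-leg line from a momentum-space representation -/

/-- **PLAIN FOUR-LEG LINE FROM A MOMENTUM-SPACE REPRESENTATION** (see the module docstring): representation `hker` = amplitudes `a_i` × conserving transfer
bumps (normalisation `κ`, symbols `G_i` with (T1)-bump data: rates `(s₀ⁱ,s₁ⁱ) ∈ (0,1]²`, sizes `A_i`, supports `≤ n₀(s₀ⁱ·2M)(s₁ⁱL)²`, time/axis second
differences) + a remainder `ρ` whose plane-wave transform has plain line `≤ r` ⟹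
`fixedTupleL1 L M β 3 (sectorisedKernel … trivialMultiplier 𝒱 4) Ω y ≤ ε_x³·(‖κ‖(2M·L²)²)·√(10485760·n₀)·(2M·L²)·Σ_i‖a_i‖A_i + r`.
[cite: BenfattoGiulianiMastropietro2006, §3 (3.65)] -/
theorem plainFourLegLine_of_momentumRepresentation {ι : Type*} {β : ℝ} (hβ : 0 < β) (𝒱 : HubbardGrassmann L M) (σ : Fin 4 → Fin 2)
    (S : Finset ι) (a : ι → ℂ) (κ : ℂ) (G : ι → TorusSite 1 (2 * M) × TorusSite 2 L → ℂ) (ρ : (Fin 4 → FreqMomentum L M) → ℂ)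
    (hker : ∀ k : Fin 4 → FreqMomentum L M,
      kernel ℂ 𝒱 4 (fun i => ((k i, σ i), (![0, 0, 1, 1] : Fin 4 → Fin 2) i)) =
        ∑ i ∈ S, a i * (κ * (if ((fun _ : Fin 1 => ((((k 0).1 : ℕ) : ZMod (2 * M)))), (k 0).2) + ((fun _ : Fin 1 => ((((k 1).1 : ℕ) : ZMod (2 * M)))), (k 1).2) = (((fun _ : Fin 1 => ((((k 2).1 : ℕ) : ZMod (2 * M)))), (k 2).2) : TorusSite 1 (2 * M) × TorusSite 2 L) + ((fun _ : Fin 1 => ((((k 3).1 : ℕ) : ZMod (2 * M)))), (k 3).2) then (fun Q => G i (-Q)) (((fun _ : Fin 1 => ((((k 0).1 : ℕ) : ZMod (2 * M)))), (k 0).2) + ((fun _ : Fin 1 => ((((k 1).1 : ℕ) : ZMod (2 * M)))), (k 1).2)) else 0)) + ρ k)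
    (s₀ s₁ A : ι → ℝ) (Ns : ι → ℕ) {n₀ r : ℝ} (hn₀ : 0 ≤ n₀)
    (hs₀ : ∀ i ∈ S, 0 < s₀ i) (hs₀1 : ∀ i ∈ S, s₀ i ≤ 1) (hs₁ : ∀ i ∈ S, 0 < s₁ i) (hs₁1 : ∀ i ∈ S, s₁ i ≤ 1)
    (hA : ∀ i ∈ S, 0 ≤ A i) (hNs : ∀ i ∈ S, (Ns i : ℝ) ≤ n₀ * (s₀ i * (2 * M : ℕ)) * (s₁ i * L) ^ 2)
    (hsupp : ∀ i ∈ S, (univ.filter fun q => G i q ≠ 0).card ≤ Ns i) (hsup : ∀ i ∈ S, ∀ q, ‖G i q‖ ≤ A i)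
    (h₀ : ∀ i ∈ S, ∀ q, ‖(fwdDiff ((fun _ : Fin 1 => (1 : ZMod (2 * M))), (0 : TorusSite 2 L)))^[2] (G i) q‖ ≤
      A i * (4 / (s₀ i * (2 * M : ℕ))) ^ 2)
    (h₁ : ∀ i ∈ S, ∀ q (j : Fin 2), ‖(fwdDiff ((0 : TorusSite 1 (2 * M)), (Pi.single j (1 : ZMod L) : TorusSite 2 L)))^[2] (G i) q‖ ≤
      A i * (4 / (s₁ i * L)) ^ 2)
    (hr : ∀ y : SpaceTimeIdx L M, fixedTupleL1 L M β 3
      (fun (Ω : Fin 4 → SectorLeg 1) (x : Fin 4 → SpaceTimeIdx L M) =>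
        ∑ k : Fin 4 → FreqMomentum L M, (∏ i, trivialMultiplier L M (Ω i).1.1 (k i) * hubbardPlaneWave L M β (Ω i).2 (k i) (x i)) * ρ k)
      (fun i : Fin 4 => ((((0 : Fin 1), σ i) : Fin 1 × Fin 2), (![0, 0, 1, 1] : Fin 4 → Fin 2) i)) y ≤ r)
    (y : SpaceTimeIdx L M) :
    fixedTupleL1 L M β 3 (sectorisedKernel L M β (trivialMultiplier L M) 𝒱 4) (fun i : Fin 4 => ((((0 : Fin 1), σ i) : Fin 1 × Fin 2), (![0, 0, 1, 1] : Fin 4 → Fin 2) i)) y ≤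
      imagTimeWeight β M ^ 3 * ((‖κ‖ * ((((2 * M : ℕ) : ℝ) * (L : ℝ) ^ 2) ^ 2)) * (Real.sqrt (10485760 * n₀) * (((2 * M : ℕ) : ℝ) * (L : ℝ) ^ 2))) *
        ∑ i ∈ S, ‖a i‖ * A i + r := by
  classical
  have hβ0 : β ≠ 0 := hβ.ne'
  -- the position-level pieces
  refine (fixedTupleL1_le_of_pairTransfer_superposition hβ.le S a (sectorisedKernel L M β (trivialMultiplier L M) 𝒱 4)
    (fun (Ω : Fin 4 → SectorLeg 1) (x : Fin 4 → SpaceTimeIdx L M) =>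
      ∑ k : Fin 4 → FreqMomentum L M, (∏ i, trivialMultiplier L M (Ω i).1.1 (k i) * hubbardPlaneWave L M β (Ω i).2 (k i) (x i)) * ρ k)
    (fun (i : ι) (Ω : Fin 4 → SectorLeg 1) (x : Fin 4 → SpaceTimeIdx L M) =>
      ∑ k : Fin 4 → FreqMomentum L M, (∏ j, trivialMultiplier L M (Ω j).1.1 (k j) * hubbardPlaneWave L M β (Ω j).2 (k j) (x j)) *
        (κ * (if ((fun _ : Fin 1 => ((((k 0).1 : ℕ) : ZMod (2 * M)))), (k 0).2) + ((fun _ : Fin 1 => ((((k 1).1 : ℕ) : ZMod (2 * M)))), (k 1).2) = (((fun _ : Fin 1 => ((((k 2).1 : ℕ) : ZMod (2 * M)))), (k 2).2) : TorusSite 1 (2 * M) × TorusSite 2 L) + ((fun _ : Fin 1 => ((((k 3).1 : ℕ) : ZMod (2 * M)))), (k 3).2) then (fun Q => G i (-Q)) (((fun _ : Fin 1 => ((((k 0).1 : ℕ) : ZMod (2 * M)))), (k 0).2) + ((fun _ : Fin 1 => ((((k 1).1 : ℕ) : ZMod (2 * M)))), (k 1).2)) else 0)))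
    (fun i : Fin 4 => ((((0 : Fin 1), σ i) : Fin 1 × Fin 2), (![0, 0, 1, 1] : Fin 4 → Fin 2) i)) (fun x => ?_) G (c := ‖κ‖ * ((((2 * M : ℕ) : ℝ) * (L : ℝ) ^ 2) ^ 2)) (by positivity) (fun i hi x => ?_)
    s₀ s₁ A Ns hn₀ hs₀ hs₀1 hs₁ hs₁1 hA hNs hsupp hsup h₀ h₁ y).trans (add_le_add le_rfl (hr y))
  · -- `hW`: linearity of the plane-wave sum in the kernel
    rw [sectorisedKernel_def]
    simp_rw [hker, mul_add, sum_add_distrib]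
    congr 1
    simp_rw [mul_sum]
    rw [sum_comm]
    exact sum_congr rfl fun i _ => sum_congr rfl fun k _ => by ring
  · -- `hB`: the dictionary, symbol `Q ↦ G i (−(−Q)) = G i Q`
    refine (norm_planeWaveSum_le_pairTransfer_of_conserving hβ0 σ
      (fun k => κ * (if ((fun _ : Fin 1 => ((((k 0).1 : ℕ) : ZMod (2 * M)))), (k 0).2) + ((fun _ : Fin 1 => ((((k 1).1 : ℕ) : ZMod (2 * M)))), (k 1).2) = (((fun _ : Fin 1 => ((((k 2).1 : ℕ) : ZMod (2 * M)))), (k 2).2) : TorusSite 1 (2 * M) × TorusSite 2 L) + ((fun _ : Fin 1 => ((((k 3).1 : ℕ) : ZMod (2 * M)))), (k 3).2) then (fun Q => G i (-Q)) (((fun _ : Fin 1 => ((((k 0).1 : ℕ) : ZMod (2 * M)))), (k 0).2) + ((fun _ : Fin 1 => ((((k 1).1 : ℕ) : ZMod (2 * M)))), (k 1).2)) else 0)) κ (fun Q => G i (-Q)) (fun k => rfl) x).trans (le_of_eq ?_)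
    first
      | rfl
      | simp only [neg_neg]

end Summit.HubbardSuperconductivity.HubbardSuperconductivity.Theorems.TorusFourierL2

end
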